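import Mathlib
import HarnessLib

/-!
# The `p`-adic stationary phase formula, even exponent (Dąbrowski–Fisher 1997, Thm. 1.8 (a))

Topic `NumberTheory/GaussSums`, namespace `Literature.NumberTheory.GaussSums`. ONE named fact
(a theorem in print, `def … : Prop`, D-0014), filed by a grounder for route
`QuantumAdvantage/TwoAdicStationaryPhase`, whose support
`Summit.QuantumAdvantage.QuantumAdvantage.Theses.TwoAdicStationaryPhase.TspChainLocalisation`
(item `stmt-QuantumAdvantage-2650`) and clause (i) of the informal item `TspMultiRegister`
(`stmt-QuantumAdvantage-2727`) are its case `p = 2`, `m = 2c`, `V = 𝔸ᵏ`, `f = Φ` (the path-sum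
phase): `Σ_{v ∈ (ℤ/4^c)^k} e(Φ(v)/4^c) = 2^{ck} Σ_{a ∈ (ℤ/2^c)^k, ∇Φ(a) ≡ 0 (2^c)} e(Φ(ã)/4^c)`.

* **R. Dąbrowski, B. Fisher**, *A stationary phase formula for exponential sums over `ℤ/p^mℤ`
  and applications to GL(3)-Kloosterman sums*, Acta Arith. 80 (1997) 1–48
  (doi:10.4064/aa-80-1-1-48; open copy READ, PDF p. 7 Notation 1.1 and (1.1), p. 10 Thm. 1.8):
  "Notation 1.1. … `p` is a prime, … `V` is a smooth scheme of dimension `n ≥ 1` over `ℤ_p`,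
  `f : V → 𝔸¹` is a `ℤ_p`-morphism, and `D ⊆ V` is the scheme of critical points of `f`. … We let
  `m` be an integer greater than `1` and let (1.1) `S = S_{m,V,f} = Σ_{x ∈ V(ℤ/p^mℤ)} e^{2πi f(x)/p^m}`."
  "**Theorem 1.8.** Let `m` and `j` be positive integers, with `j ≤ m`. Let `S` be as in (1.1)
  and, for `x̄ ∈ V(ℤ/p^jℤ)`, let `S_x̄` represent the sum over all `x ∈ V(ℤ/p^mℤ)` that reduce to
  `x̄`, so that `S = Σ_x̄ S_x̄`. (a) If `2j ≤ m` then `S_x̄ = 0` unless `x̄ ∈ D(ℤ/p^jℤ)`. Now let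
  `m = 2j` or `2j + 1` and let `x ∈ V(ℤ/p^mℤ)` map to `x̄ ∈ D(ℤ/p^jℤ)`. If `m = 2j` then
  `S_x̄ = p^{nm/2} e^{2πi f(x)/p^m}`. If `m = 2j+1` then `S_x̄ = p^{nm/2} e^{2πi f(x)/p^m} G₁(H_x̄, p^{−j} grad f(x))`."
  (Remark 1.9 (2), p. 11: part (a) "follows from the fact that the sum of a non-trivial character
  over a finite group vanishes"; no restriction on the prime `p` in part (a).)

## Rendering (the case vendored)

* `V = 𝔸ⁿ` (affine space: `V(ℤ/p^mℤ) = (ℤ/p^mℤ)ⁿ`), `f` a polynomial with INTEGER coefficients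
  (`MvPolynomial (Fin n) ℤ` ⊂ `ℤ_p[x]`, evaluated in `ZMod (p^m)` / `ZMod (p^j)` through
  `Int.castRingHom`), `D(ℤ/p^jℤ) = {x̄ | ∂f/∂x_i (x̄) = 0 in ℤ/p^j for all i}`
  (`MvPolynomial.pderiv`), and the EVEN exponent `m = 2j`, `j ≥ 1` (so `m > 1` as in Notation 1.1).
* `e^{2πi t/p^m}` is Mathlib's standard additive character `ZMod.stdAddChar : AddChar (ZMod N) ℂ`
  (`t ↦ exp (2πi t/N)`).
* Both printed clauses of (a) for `m = 2j` in one equation: for every `x ∈ (ℤ/p^{2j})ⁿ` with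
  reduction `x̄`, `S_x̄ = p^{nj} e(f(x)/p^{2j})` if `x̄` is critical and `S_x̄ = 0` otherwise
  (`p^{nm/2} = p^{nj}`). The odd case `m = 2j+1` (Gauss-sum factor `G₁`, with the `p = 2`
  convention of Def. 1.2) and part (b) are NOT vendored here.

## References

* R. Dąbrowski, B. Fisher, Acta Arith. 80 (1997), no. 1, 1–48, Notation 1.1, (1.1), Thm. 1.8 (a),
  Remark 1.9 (2). [`DabrowskiFisher1997`]
* B. Fisher, *The stationary-phase method for exponential sums with multiplicative characters*,
  J. Number Theory 96 (2002) (generalisation; not used here). [`Fisher2002`]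
-/

namespace Literature.NumberTheory.GaussSums

open MvPolynomial

/-- Reduction `ℤ/p^{2j} → ℤ/p^j`, coordinatewise on `(ℤ/p^{2j})ⁿ`. [folklore] -/
def reducePow (p n j : ℕ) (x : Fin n → ZMod (p ^ (2 * j))) : Fin n → ZMod (p ^ j) :=
  fun i => ZMod.castHom (pow_dvd_pow p (by omega : j ≤ 2 * j)) (ZMod (p ^ j)) (x i)

/-- **Dąbrowski–Fisher 1997, Thm. 1.8 (a), even exponent, affine space.** For a prime `p`,
`j ≥ 1`, `m = 2j`, a polynomial `f ∈ ℤ[x_1, …, x_n]` and `x ∈ (ℤ/p^mℤ)ⁿ` with reduction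
`x̄ ∈ (ℤ/p^jℤ)ⁿ`: the partial sum `S_x̄ = Σ_{y ≡ x̄ (p^j)} e^{2πi f(y)/p^m}` over all
`y ∈ (ℤ/p^mℤ)ⁿ` reducing to `x̄` equals `p^{nm/2} e^{2πi f(x)/p^m}` if `x̄` is a critical point of
`f` modulo `p^j` (`∂f/∂x_i(x̄) = 0` in `ℤ/p^j` for all `i`) and `0` otherwise (PDF p. 10; "the sum
of a non-trivial character over a finite group vanishes", Remark 1.9 (2)). Grounds
`Summit.QuantumAdvantage.QuantumAdvantage.Theses.TwoAdicStationaryPhase.TspChainLocalisation`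
(`p = 2`, `j = c`, `f = Φ`, summed over `x̄`) and clause (i) of `TspMultiRegister`.
[cite: DabrowskiFisher1997, Thm. 1.8 (a)] -/
def dabrowskiFisher1997_thm18a_even : Prop :=
  ∀ (p : ℕ) [Fact p.Prime] (n j : ℕ) (f : MvPolynomial (Fin n) ℤ), 1 ≤ j →
    ∀ x : Fin n → ZMod (p ^ (2 * j)),
      (∑ y ∈ (Finset.univ : Finset (Fin n → ZMod (p ^ (2 * j)))).filter
          (fun y => reducePow p n j y = reducePow p n j x),
        ZMod.stdAddChar (N := p ^ (2 * j))
          (MvPolynomial.eval y (MvPolynomial.map (Int.castRingHom (ZMod (p ^ (2 * j)))) f))) =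
      if ∀ i : Fin n,
          MvPolynomial.eval (reducePow p n j x)
            (MvPolynomial.map (Int.castRingHom (ZMod (p ^ j))) (MvPolynomial.pderiv i f)) = 0
      then (p : ℂ) ^ (n * j) *
        ZMod.stdAddChar (N := p ^ (2 * j))
          (MvPolynomial.eval x (MvPolynomial.map (Int.castRingHom (ZMod (p ^ (2 * j)))) f))
      else 0

end Literature.NumberTheory.GaussSums
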